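import Literature.MathematicalPhysics.StatisticalMechanics.ComplexSpinFluctuationBound
import Literature.Probability.LatticeModels.LatticeGreenOriginBound
import HarnessLib

/-!
# Chiral long-range order at strong coupling in high dimension, without numerics
# (Salmhofer–Seiler, CMP 139 (1991), Prop. 4.2 (2) with Lemma A.4; Thm. 4.8, Cor. 4.9)

Twelfth file of the Salmhofer–Seiler series; theorems only.  `ComplexSpinFluctuationBound` proves
Thm. 4.8 (4.42) / Cor. 4.9 with the printed constant `S(ν)` (4.3) in the form "for all large even
`L`, `|Λ|⁻¹∑_x⟨σ_0σ_x⟩_Λ ≥ (1/4ν)(1/K(N) - 2S(ν)/N) - ε`" together with `S(ν) ≤ νR(ν) - 3/4`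
(Remark A.5), and `LatticeGreenOriginBound` proves Lemma A.4, `R(ν) ≤ 1/(ν - 2)`.  Here the two are
combined:

* `fluctS_le_dim` — **Prop. 4.2 (2) (4.4), both inequalities**: `S(ν) ≤ νR(ν) - 3/4 ≤ ν/(ν-2) - 3/4`
  (`ν ≥ 3`);
* `uN_chiralLRO_of_dim` — Cor. 4.9's conclusion for the `U(N)` model (`1 ≤ N ≤ 4`) in every
  dimension `ν` with `2(ν/(ν-2) - 3/4)K(N)/N < 1`: constants `c > 0`, `L₀` with
  `|Λ|⁻¹∑_x⟨σ_0σ_x⟩_Λ ≥ c` for all even `L ≥ L₀` (chiral LRO at `m = 0`, `β = 0`, uniform in the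
  volume) — Thm. 4.8 ("there is a `ν₀ ≥ 3` so that long-range order holds at `m = 0` for all
  `ν ≥ ν₀`") made explicit with the ANALYTIC Prop. 4.2 (2) in place of the computer-assisted
  Prop. 4.2 (4);
* `chiralLRO_of_dim` — the same for any complex spin system under Thm. 4.8's hypotheses;
* `u1_chiralLRO_of_le`, `u2_chiralLRO_of_le`, `u3_chiralLRO_of_le`, `u4_chiralLRO_of_le` — the
  explicit thresholds `ν ≥ 11` (`N = 1`: strongly coupled lattice QED; `N = 2`), `ν ≥ 13` (`N = 3`),
  `ν ≥ 20` (`N = 4`), from `K(1) = 1`, `K(2) = 2`, `K(3) = 10/3`, `K(4) = 83/15` (`sdK_uN_*`);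
  `u5_chiralLRO_of_le` — `N = 5` with the corrected `K(5) = 12227/1330`: `ν ≥ 94`.

The printed Cor. 4.9 ("`N ≤ 4` and `ν ≥ 4`") needs the numerical `S(4) < 0.35` of Prop. 4.2 (4)
(not formalised); the thresholds above are what the printed analytic bounds alone certify.  Honest
framing: `β = 0` complex spin systems (the `U(N)` one-link integral in Salmhofer–Seiler's bosonised
form) on even tori; nothing about `β > 0`, the continuum, `SU(N)` or the summit's `QCD` conjunct.

## References

* M. Salmhofer, E. Seiler, Commun. Math. Phys. 139 (1991) 395–432, Prop. 4.2 (2) (4.4), Lemma A.4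
  (A.23), Remark A.5 (A.28), Thm. 4.8, Cor. 4.9. [SalmhoferSeiler1991]
-/

noncomputable section

open MeasureTheory Set Filter Finset
open Literature.Probability.LatticeModels

namespace Literature.MathematicalPhysics.StatisticalMechanics

namespace ComplexSpin

variable {ν : ℕ}

/-- **Prop. 4.2 (2) (4.4) = Remark A.5 (A.28): `S(ν) ≤ νR(ν) - 3/4 ≤ ν/(ν-2) - 3/4`** for `ν ≥ 3`
(the second inequality is Lemma A.4 (2), `R(ν) ≤ 1/(ν-2)`, `latticeGreen_zero_le_inv_sub_two`).
[cite: SalmhoferSeiler1991, Prop. 4.2 (2) (4.4)] -/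
theorem fluctS_le_dim (hν : 3 ≤ ν) : fluctS ν ≤ (ν : ℝ) / ((ν : ℝ) - 2) - 3 / 4 := by
  have h1 := fluctS_le hν
  have h2 := latticeGreen_zero_le_inv_sub_two (d := ν) hν
  have h3 : (ν : ℝ) * latticeGreen (0 : Site ν) ≤ ν * (1 / ((ν : ℝ) - 2)) :=
    mul_le_mul_of_nonneg_left h2 (Nat.cast_nonneg ν)
  rw [mul_one_div] at h3
  linarith

/-- **Thm. 4.8 with the analytic Prop. 4.2 (2)**: for a complex spin system with `B = exp(NW)` to
order `N`, `w₁ = 1`, `w_k ≥ 0`, in every dimension `ν ≥ 3` with `2(ν/(ν-2) - 3/4)K(N)/N < 1` there are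
`c > 0` and `L₀` with `|Λ|⁻¹∑_x⟨σ_0σ_x⟩_Λ ≥ c` for all even `L ≥ L₀` (chiral LRO at `m = 0`, uniform in
the volume) — "there is a `ν₀ ≥ 3` so that long-range order holds at `m = 0` for all `ν ≥ ν₀`", with
`ν₀` read off from (A.28) and (A.23) instead of (4.5). [cite: SalmhoferSeiler1991, Thm. 4.8 with Prop. 4.2 (2)] -/
theorem chiralLRO_of_dim (hν : 3 ≤ ν) {N : ℕ} (hN : 1 ≤ N)
    {a w : ℕ → ℝ} (hlog : HasLog N a w) (ha0 : a 0 = 1) (hw1 : w 1 = 1)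
    (hw : ∀ k, 2 ≤ k → k ≤ N → 0 ≤ w k)
    (hcond : 2 * ((ν : ℝ) / ((ν : ℝ) - 2) - 3 / 4) * sdK N w / N < 1) :
    ∃ c : ℝ, 0 < c ∧ ∃ L₀ : ℕ, ∀ (L : ℕ) [NeZero L], Even L → L₀ ≤ L →
      c ≤ (Fintype.card (TorusSite ν L) : ℝ)⁻¹ *
          ∑ x : TorusSite ν L, expect N 0 a (MvPolynomial.X (0 : TorusSite ν L) * MvPolynomial.X x) := by
  have hK : 0 < sdK N w := lt_of_lt_of_le one_pos (one_le_sdK hN hw1 hw)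
  have hNpos : (0 : ℝ) < N := by exact_mod_cast hN
  refine chiralLRO_of_fluctS_lt hν hN hlog ha0 hw1 hw (lt_of_le_of_lt ?_ hcond)
  have h := fluctS_le_dim (ν := ν) hν
  have : 2 * fluctS ν * sdK N w ≤ 2 * ((ν : ℝ) / ((ν : ℝ) - 2) - 3 / 4) * sdK N w := by
    nlinarith
  exact div_le_div_of_nonneg_right this hNpos.le

/-- **Cor. 4.9 without numerics (high dimension)**: for the `U(N)` model, `1 ≤ N ≤ 4`, in every
dimension `ν ≥ 3` with `2(ν/(ν-2) - 3/4)K(N)/N < 1` there are `c > 0` and `L₀` with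
`|Λ|⁻¹∑_x⟨σ_0σ_x⟩_Λ ≥ c` for all even `L ≥ L₀` (chiral LRO at `m = 0`, `β = 0`); e.g. `ν ≥ 11` for
`N = 1, 2`, `ν ≥ 13` for `N = 3`, `ν ≥ 20` for `N = 4` (below). [cite: SalmhoferSeiler1991, Cor. 4.9 with Thm. 4.8 and Prop. 4.2 (2)] -/
theorem uN_chiralLRO_of_dim (hν : 3 ≤ ν) {N : ℕ} (hN1 : 1 ≤ N) (hN4 : N ≤ 4)
    (hcond : 2 * ((ν : ℝ) / ((ν : ℝ) - 2) - 3 / 4) * sdK N (uNLogCoeff N) / N < 1) :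
    ∃ c : ℝ, 0 < c ∧ ∃ L₀ : ℕ, ∀ (L : ℕ) [NeZero L], Even L → L₀ ≤ L →
      c ≤ (Fintype.card (TorusSite ν L) : ℝ)⁻¹ *
          ∑ x : TorusSite ν L, expect N 0 (uNBondCoeff N)
            (MvPolynomial.X (0 : TorusSite ν L) * MvPolynomial.X x) :=
  chiralLRO_of_dim hν hN1 (hasLog_uN hN1 hN4) (uNBondCoeff_zero N) (uNLogCoeff_one N)
    (fun k hk2 hkN => uNLogCoeff_nonneg hN4 k hk2 hkN) hcond

/-- `U(1)` (strongly coupled lattice QED with massless staggered fermions, `K(1) = 1`): chiral LRO at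
`m = 0` in every dimension `ν ≥ 11`, from the analytic bound `S(ν) ≤ ν/(ν-2) - 3/4 < 1/2`.
[cite: SalmhoferSeiler1991, Cor. 4.9 with Prop. 4.2 (2)] -/
theorem u1_chiralLRO_of_le (hν : 11 ≤ ν) :
    ∃ c : ℝ, 0 < c ∧ ∃ L₀ : ℕ, ∀ (L : ℕ) [NeZero L], Even L → L₀ ≤ L →
      c ≤ (Fintype.card (TorusSite ν L) : ℝ)⁻¹ *
          ∑ x : TorusSite ν L, expect 1 0 (uNBondCoeff 1)
            (MvPolynomial.X (0 : TorusSite ν L) * MvPolynomial.X x) := by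
  refine uN_chiralLRO_of_dim (by omega) le_rfl (by norm_num) ?_
  rw [sdK_uN_one, Nat.cast_one]
  have hν' : (11 : ℝ) ≤ ν := by exact_mod_cast hν
  have h : (ν : ℝ) / ((ν : ℝ) - 2) < 5 / 4 := by
    rw [div_lt_iff₀ (by linarith)]; linarith
  linarith

/-- `U(2)` (`K(2) = 2`): chiral LRO at `m = 0` in every dimension `ν ≥ 11`.
[cite: SalmhoferSeiler1991, Cor. 4.9 with Prop. 4.2 (2)] -/
theorem u2_chiralLRO_of_le (hν : 11 ≤ ν) :
    ∃ c : ℝ, 0 < c ∧ ∃ L₀ : ℕ, ∀ (L : ℕ) [NeZero L], Even L → L₀ ≤ L →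
      c ≤ (Fintype.card (TorusSite ν L) : ℝ)⁻¹ *
          ∑ x : TorusSite ν L, expect 2 0 (uNBondCoeff 2)
            (MvPolynomial.X (0 : TorusSite ν L) * MvPolynomial.X x) := by
  refine uN_chiralLRO_of_dim (by omega) (by norm_num) (by norm_num) ?_
  rw [sdK_uN_two, Nat.cast_ofNat]
  have hν' : (11 : ℝ) ≤ ν := by exact_mod_cast hν
  have h : (ν : ℝ) / ((ν : ℝ) - 2) < 5 / 4 := by
    rw [div_lt_iff₀ (by linarith)]; linarith
  linarith

/-- `U(3)` (`K(3) = 10/3`): chiral LRO at `m = 0` in every dimension `ν ≥ 13`.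
[cite: SalmhoferSeiler1991, Cor. 4.9 with Prop. 4.2 (2)] -/
theorem u3_chiralLRO_of_le (hν : 13 ≤ ν) :
    ∃ c : ℝ, 0 < c ∧ ∃ L₀ : ℕ, ∀ (L : ℕ) [NeZero L], Even L → L₀ ≤ L →
      c ≤ (Fintype.card (TorusSite ν L) : ℝ)⁻¹ *
          ∑ x : TorusSite ν L, expect 3 0 (uNBondCoeff 3)
            (MvPolynomial.X (0 : TorusSite ν L) * MvPolynomial.X x) := by
  refine uN_chiralLRO_of_dim (by omega) (by norm_num) (by norm_num) ?_
  rw [sdK_uN_three, Nat.cast_ofNat]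
  have hν' : (13 : ℝ) ≤ ν := by exact_mod_cast hν
  have h : (ν : ℝ) / ((ν : ℝ) - 2) < 6 / 5 := by
    rw [div_lt_iff₀ (by linarith)]; linarith
  linarith

/-- `U(4)` (`K(4) = 83/15`): chiral LRO at `m = 0` in every dimension `ν ≥ 20`.
[cite: SalmhoferSeiler1991, Cor. 4.9 with Prop. 4.2 (2)] -/
theorem u4_chiralLRO_of_le (hν : 20 ≤ ν) :
    ∃ c : ℝ, 0 < c ∧ ∃ L₀ : ℕ, ∀ (L : ℕ) [NeZero L], Even L → L₀ ≤ L →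
      c ≤ (Fintype.card (TorusSite ν L) : ℝ)⁻¹ *
          ∑ x : TorusSite ν L, expect 4 0 (uNBondCoeff 4)
            (MvPolynomial.X (0 : TorusSite ν L) * MvPolynomial.X x) := by
  refine uN_chiralLRO_of_dim (by omega) (by norm_num) le_rfl ?_
  rw [sdK_uN_four, Nat.cast_ofNat]
  have hν' : (20 : ℝ) ≤ ν := by exact_mod_cast hν
  have h : (ν : ℝ) / ((ν : ℝ) - 2) < 369 / 332 := by
    rw [div_lt_iff₀ (by linarith)]; linarith
  linarith

/-- `U(5)` with the CORRECTED `K(5) = 12227/1330` (erratum to (4.27), `ComplexSpinChiralLRO`): chiral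
LRO at `m = 0` in every dimension `ν ≥ 94` from the analytic bound (the printed "`N = 5`, `ν ≥ 5`"
rests on the numerics of Prop. 4.2 (4) and the misprinted `K(5) < 7.4`).
[cite: SalmhoferSeiler1991, Cor. 4.9 (case `N = 5`) with Prop. 4.2 (2)] -/
theorem u5_chiralLRO_of_le (hν : 94 ≤ ν) :
    ∃ c : ℝ, 0 < c ∧ ∃ L₀ : ℕ, ∀ (L : ℕ) [NeZero L], Even L → L₀ ≤ L →
      c ≤ (Fintype.card (TorusSite ν L) : ℝ)⁻¹ *
          ∑ x : TorusSite ν L, expect 5 0 (uNBondCoeff 5)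
            (MvPolynomial.X (0 : TorusSite ν L) * MvPolynomial.X x) := by
  refine chiralLRO_of_dim (by omega) (by norm_num : 1 ≤ 5) hasLog_uN_five (uNBondCoeff_zero 5)
    (by simp [Function.update, uNLogCoeff]) (fun k hk2 hk5 => by
      interval_cases k <;> simp [Function.update, uNLogCoeff] <;> norm_num) ?_
  rw [sdK_uN_five, Nat.cast_ofNat]
  have hν' : (94 : ℝ) ≤ ν := by exact_mod_cast hν
  have h : (ν : ℝ) / ((ν : ℝ) - 2) < 49981 / 48908 := by
    rw [div_lt_iff₀ (by linarith)]; linarith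
  linarith

end ComplexSpin

end Literature.MathematicalPhysics.StatisticalMechanics

end
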